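import Literature.Analysis.SpecialFunctions.SpheroidalHarmonicEigenfunction
import Mathlib.MeasureTheory.Integral.IntervalIntegral.FundThmCalculus
import HarnessLib

/-!
# The spheroidal shooting function: derivative in the eigenvalue parameter and its
# non-degeneracy at real zeros (the Lagrange identity)

Topic `Literature/Analysis/SpecialFunctions` (namespace `Literature.Analysis.SpecialFunctions`),
continuing `SpheroidalHarmonicSeries.lean` / `SpheroidalHarmonicEigenfunction.lean`. For the
Frobenius solution `q(t; m, ν, κ) = Σ cₖ(m; ν, κ) tᵏ` of the `m`-spheroidal equation in the pole
variable `t = 1 − x` (SR, CMP 329 (2014), §2 (2.1), App. B) and the **shooting function**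
`F(ν, κ) = q'(1; m, ν, κ)` (whose zeros are the eigenvalues, `λ = ν + m(m+1)`), this file proves:

* `sphmCoeffD` — the `ν`-derivatives `c'ₖ = ∂cₖ/∂ν` (polynomials in `(ν, κ)`) and the
  **differentiated recursion** `2(k+1)(k+m+1) c'_{k+1} = (k(k+2m+1) − ν − κ) c'ₖ − cₖ + 2κ c'_{k−1} − κ c'_{k−2}`;
* `sphmFunD = Σ c'ₖ tᵏ = ∂q/∂ν` and its `t`-derivatives: on `‖t‖ < 5/4` these are the `ν`-derivatives
  of `q`, `q'` (`hasDerivAt_sphmFun_nu`, `hasDerivAt_sphmDer_nu` — the mixed partials are exchanged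
  structurally, through the smooth dependence of the rescaled coefficient sequence on `ν` in
  `ℕ →ᵇ ℂ`, `Literature.Analysis.ODE.contDiffAt_affineFix`, and the evaluation functionals
  `evCLM`), and the **inhomogeneous equation**
  `t(2 − t) W'' + 2(m+1)(1 − t) W' + (ν + κ(1 − t)²) W = −q` (`sphmFunD_ode`);
* in the latitude variable `x` (`u(x) = q(1 − x)`, `w = ∂u/∂ν`) the **Lagrange identity**
  `d/dx [(1 − x²)^{m+1} (u w' − u' w)] = −(1 − x²)^m u²` and, integrating over `[0, 1]` (the weight
  kills the pole `x = 1`), at a zero of the shooting function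
  `q(1) · ∂F/∂ν = −∫₀¹ (1 − x²)^m u(x)² dx` (`sphmFun_one_mul_deriv_shooting`);
* hence for REAL `(ν₀, κ₀)` with `F(ν₀, κ₀) = 0`: `u` is real, the integral is positive, and
  **`∂F/∂ν(ν₀, κ₀) ≠ 0` and `q(1; ν₀, κ₀) ≠ 0`** (`deriv_shooting_ne_zero`, `sphmFun_one_ne_zero`) —
  the non-degeneracy that lets the real eigenvalues be continued into holomorphic curves
  `λ_{ml}(κ)` (SR App. B: "we embed the eigenvalues into holomorphic curves").

## References

* Y. Shlapentokh-Rothman, Comm. Math. Phys. 329 (2014) 859–891, §2 (2.1), App. B.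
  Key `ShlapentokhRothman2014KleinGordon`.
* P. Hartman, *Ordinary Differential Equations*, SIAM Classics 38 (2002), Ch. XI §2 (the Lagrange
  identity for second-order self-adjoint equations), Ch. IV §12. Key `Hartman2002`.
-/

noncomputable section

open Set Filter Metric Topology MeasureTheory intervalIntegral
open scoped ContDiff

namespace Literature.Analysis.SpecialFunctions

open Literature.Analysis.ODE

/-! ### Generic unit-disc series in the pole variable and the spheroidal operator on coefficients -/

section Generic

variable {a : ℕ → ℂ} (m : ℕ) (ν κ : ℂ)

/-- The series `Σ aₖ ((4/5) t)ᵏ` in the pole variable (evaluation radius `5/4`). [folklore] -/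
def ser (a : ℕ → ℂ) (t : ℂ) : ℂ := cseries a ((4 / 5 : ℂ) * t)

/-- Its first `t`-derivative series. [folklore] -/
def serD (a : ℕ → ℂ) (t : ℂ) : ℂ := 4 / 5 * cseries (dSeq a) ((4 / 5 : ℂ) * t)

/-- Its second `t`-derivative series. [folklore] -/
def serD2 (a : ℕ → ℂ) (t : ℂ) : ℂ := (4 / 5) ^ 2 * cseries (dSeq (dSeq a)) ((4 / 5 : ℂ) * t)

variable {m ν κ}

/-- `d/dt ser = serD` on `‖t‖ < 5/4`. [folklore] -/
theorem hasDerivAt_ser (ha : PolyBounded a) {t : ℂ} (ht : ‖t‖ < 5 / 4) : HasDerivAt (ser a) (serD a t) t := by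
  have h := hasDerivAt_cseries ha (norm_rescale_lt ht)
  have hlin : HasDerivAt (fun t : ℂ ↦ (4 / 5 : ℂ) * t) (4 / 5) t := by
    simpa using (hasDerivAt_id t).const_mul (4 / 5 : ℂ)
  have h2 : HasDerivAt (fun t : ℂ ↦ cseries a ((4 / 5 : ℂ) * t)) (cseries (dSeq a) ((4 / 5 : ℂ) * t) * (4 / 5)) t :=
    h.comp t hlin
  rw [show ser a = fun t : ℂ ↦ cseries a ((4 / 5 : ℂ) * t) from rfl, serD, mul_comm]
  exact h2

/-- `d/dt serD = serD2` on `‖t‖ < 5/4`. [folklore] -/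
theorem hasDerivAt_serD (ha : PolyBounded a) {t : ℂ} (ht : ‖t‖ < 5 / 4) : HasDerivAt (serD a) (serD2 a t) t := by
  have h := hasDerivAt_cseries ha.dSeq (norm_rescale_lt ht)
  have hlin : HasDerivAt (fun t : ℂ ↦ (4 / 5 : ℂ) * t) (4 / 5) t := by
    simpa using (hasDerivAt_id t).const_mul (4 / 5 : ℂ)
  have h2 : HasDerivAt (fun t : ℂ ↦ cseries (dSeq a) ((4 / 5 : ℂ) * t))
      (cseries (dSeq (dSeq a)) ((4 / 5 : ℂ) * t) * (4 / 5)) t := h.comp t hlin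
  have h3 := h2.const_mul (4 / 5 : ℂ)
  rw [show serD a = fun t : ℂ ↦ (4 / 5 : ℂ) * cseries (dSeq a) ((4 / 5 : ℂ) * t) from rfl]
  refine h3.congr_deriv ?_
  rw [serD2]
  ring

/-- **The spheroidal operator on coefficients**: the coefficient sequence of
`t(2 − t) Q'' + 2(m+1)(1 − t) Q' + (ν + κ(1 − t)²) Q` for `Q = ser a` (as a series in
`s = (4/5)t`). [folklore] -/
def odeCoeffOf (m : ℕ) (ν κ : ℂ) (a : ℕ → ℂ) (k : ℕ) : ℂ :=
  8 / 5 * shiftSeq (dSeq (dSeq a)) k - shiftSeq (shiftSeq (dSeq (dSeq a))) k +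
    8 * ((m : ℂ) + 1) / 5 * dSeq a k - 2 * ((m : ℂ) + 1) * shiftSeq (dSeq a) k +
    (ν + κ) * a k - 5 / 2 * κ * shiftSeq a k + 25 / 16 * κ * shiftSeq (shiftSeq a) k

/-- The operator on coefficients preserves polynomial growth. [folklore] -/
theorem PolyBounded.odeCoeffOf (ha : PolyBounded a) : PolyBounded (odeCoeffOf m ν κ a) := by
  have hDa : PolyBounded (dSeq a) := ha.dSeq
  have hDDa : PolyBounded (dSeq (dSeq a)) := hDa.dSeq
  exact ((((((hDDa.shift.const_mul _).sub hDDa.shift.shift).add (hDa.const_mul _)).sub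
    (hDa.shift.const_mul _)).add (ha.const_mul _)).sub (ha.shift.const_mul _)).add
    (ha.shift.shift.const_mul _)

/-- **The operator on coefficients in terms of the recursion**: for all `k`,
`(L a)ₖ = (4/5)ᵏ⁻… ` — precisely, with `bₖ = aₖ (4/5)ᵏ` (so `aₖ = bₖ (5/4)ᵏ`),
`(L a)ₖ = (5/4)ᵏ (2(k+1)(k+m+1) b_{k+1} − (k(k+2m+1) − ν − κ) bₖ − 2κ b_{k−1} + κ b_{k−2})`; stated
for coefficient functions of the form `aₖ = bₖ (5/4)ᵏ`. [folklore] -/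
theorem odeCoeffOf_resc (m : ℕ) (ν κ : ℂ) (b : ℕ → ℂ) (k : ℕ) :
    odeCoeffOf m ν κ (fun j ↦ b j * (5 / 4) ^ j) (k + 2) =
      (5 / 4 : ℂ) ^ (k + 2) *
        (2 * ((k : ℂ) + 3) * (((k : ℂ) + 2) + m + 1) * b (k + 3) -
          (((k : ℂ) + 2) * ((k : ℂ) + 2 + 2 * m + 1) - ν - κ) * b (k + 2) - 2 * κ * b (k + 1) + κ * b k) := by
  simp only [odeCoeffOf, shiftSeq_succ, dSeq_apply]
  push_cast
  ring

/-- The same at index `1`. [folklore] -/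
theorem odeCoeffOf_resc_one (m : ℕ) (ν κ : ℂ) (b : ℕ → ℂ) :
    odeCoeffOf m ν κ (fun j ↦ b j * (5 / 4) ^ j) 1 =
      (5 / 4 : ℂ) * (2 * (2 : ℂ) * ((1 : ℂ) + m + 1) * b 2 - ((1 : ℂ) * (1 + 2 * m + 1) - ν - κ) * b 1 - 2 * κ * b 0) := by
  simp only [odeCoeffOf, shiftSeq_zero, shiftSeq_succ, dSeq_apply]
  push_cast
  ring

/-- The same at index `0`. [folklore] -/
theorem odeCoeffOf_resc_zero (m : ℕ) (ν κ : ℂ) (b : ℕ → ℂ) :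
    odeCoeffOf m ν κ (fun j ↦ b j * (5 / 4) ^ j) 0 =
      2 * (1 : ℂ) * ((0 : ℂ) + m + 1) * b 1 - ((0 : ℂ) * (0 + 2 * m + 1) - ν - κ) * b 0 := by
  simp only [odeCoeffOf, shiftSeq_zero, dSeq_apply]
  push_cast
  ring

/-- **The operator identity**: for polynomially bounded `a` and `‖t‖ < 5/4`,
`t(2 − t) serD2 + 2(m+1)(1 − t) serD + (ν + κ(1 − t)²) ser = ser (L a)`. [folklore] -/
theorem ser_ode_identity (ha : PolyBounded a) {t : ℂ} (ht : ‖t‖ < 5 / 4) :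
    t * (2 - t) * serD2 a t + 2 * ((m : ℂ) + 1) * (1 - t) * serD a t + (ν + κ * (1 - t) ^ 2) * ser a t =
      ser (odeCoeffOf m ν κ a) t := by
  set s : ℂ := (4 / 5 : ℂ) * t with hs_def
  have hs : ‖s‖ < 1 := norm_rescale_lt ht
  have hDa : PolyBounded (dSeq a) := ha.dSeq
  have hDDa : PolyBounded (dSeq (dSeq a)) := hDa.dSeq
  have e1 : cseries (shiftSeq (dSeq (dSeq a))) s = s * cseries (dSeq (dSeq a)) s := cseries_shiftSeq hDDa hs
  have e2 : cseries (shiftSeq (shiftSeq (dSeq (dSeq a)))) s = s * (s * cseries (dSeq (dSeq a)) s) := by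
    rw [cseries_shiftSeq hDDa.shift hs, e1]
  have e3 : cseries (shiftSeq (dSeq a)) s = s * cseries (dSeq a) s := cseries_shiftSeq hDa hs
  have e4 : cseries (shiftSeq a) s = s * cseries a s := cseries_shiftSeq ha hs
  have e5 : cseries (shiftSeq (shiftSeq a)) s = s * (s * cseries a s) := by
    rw [cseries_shiftSeq ha.shift hs, e4]
  have hsum : cseries (odeCoeffOf m ν κ a) s =
      8 / 5 * cseries (shiftSeq (dSeq (dSeq a))) s - cseries (shiftSeq (shiftSeq (dSeq (dSeq a)))) s +
        8 * ((m : ℂ) + 1) / 5 * cseries (dSeq a) s - 2 * ((m : ℂ) + 1) * cseries (shiftSeq (dSeq a)) s +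
        (ν + κ) * cseries a s - 5 / 2 * κ * cseries (shiftSeq a) s +
        25 / 16 * κ * cseries (shiftSeq (shiftSeq a)) s := by
    have p1 : PolyBounded (fun k ↦ 8 / 5 * shiftSeq (dSeq (dSeq a)) k) := hDDa.shift.const_mul _
    have p2 : PolyBounded (fun k ↦ shiftSeq (shiftSeq (dSeq (dSeq a))) k) := hDDa.shift.shift
    have p3 : PolyBounded (fun k ↦ 8 * ((m : ℂ) + 1) / 5 * dSeq a k) := hDa.const_mul _
    have p4 : PolyBounded (fun k ↦ 2 * ((m : ℂ) + 1) * shiftSeq (dSeq a) k) := hDa.shift.const_mul _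
    have p5 : PolyBounded (fun k ↦ (ν + κ) * a k) := ha.const_mul _
    have p6 : PolyBounded (fun k ↦ 5 / 2 * κ * shiftSeq a k) := ha.shift.const_mul _
    have p7 : PolyBounded (fun k ↦ 25 / 16 * κ * shiftSeq (shiftSeq a) k) := ha.shift.shift.const_mul _
    have step : cseries (odeCoeffOf m ν κ a) s =
        cseries (fun k ↦ 8 / 5 * shiftSeq (dSeq (dSeq a)) k - shiftSeq (shiftSeq (dSeq (dSeq a))) k +
          8 * ((m : ℂ) + 1) / 5 * dSeq a k - 2 * ((m : ℂ) + 1) * shiftSeq (dSeq a) k +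
          (ν + κ) * a k - 5 / 2 * κ * shiftSeq a k) s +
        cseries (fun k ↦ 25 / 16 * κ * shiftSeq (shiftSeq a) k) s := by
      rw [← cseries_add ((((((p1.sub p2).add p3).sub p4).add p5).sub p6)) p7 hs]
      rfl
    rw [step, cseries_sub (((((p1.sub p2).add p3).sub p4).add p5)) p6 hs,
      cseries_add ((((p1.sub p2).add p3).sub p4)) p5 hs, cseries_sub (((p1.sub p2).add p3)) p4 hs,
      cseries_add ((p1.sub p2)) p3 hs, cseries_sub p1 p2 hs]
    simp only [cseries_const_mul]
  have ht' : t = 5 / 4 * s := by rw [hs_def]; ring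
  rw [ser, ser, serD, serD2, ← hs_def, hsum, e1, e2, e3, e4, e5, ht']
  ring

end Generic

/-! ### The `ν`-derivatives of the Frobenius coefficients and the differentiated recursion -/

section CoeffD

variable (m : ℕ)

/-- **The `ν`-derivative of the Frobenius coefficient** `c'ₖ(m; ν, κ) = ∂cₖ/∂ν` (a polynomial in
`(ν, κ)`). [cite: ShlapentokhRothman2014KleinGordon, App. B] -/
def sphmCoeffD (m : ℕ) (ν κ : ℂ) (k : ℕ) : ℂ := deriv (fun ν' ↦ sphmCoeff m ν' κ k) ν

/-- `ν ↦ cₖ(m; ν, κ)` is differentiable with derivative `c'ₖ`. [folklore] -/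
theorem hasDerivAt_sphmCoeff (ν κ : ℂ) (k : ℕ) :
    HasDerivAt (fun ν' ↦ sphmCoeff m ν' κ k) (sphmCoeffD m ν κ k) ν := by
  have hd : DifferentiableAt ℂ (fun ν' ↦ sphmCoeff m ν' κ k) ν :=
    ((contDiff_sphmCoeff m k (n := 1)).differentiable one_ne_zero).differentiableAt.comp ν
      (differentiableAt_id.prodMk (differentiableAt_const κ))
  exact hd.hasDerivAt

/-- `c'₀ = 0` (`c₀ = 1`). [folklore] -/
@[simp] theorem sphmCoeffD_zero (ν κ : ℂ) : sphmCoeffD m ν κ 0 = 0 := by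
  simp [sphmCoeffD]

/-- **The differentiated recursion**, index `0`: `2·1·(m+1) c'₁ = (0 − ν − κ) c'₀ − c₀`. [folklore] -/
theorem sphmCoeffD_rec_zero (ν κ : ℂ) :
    2 * (1 : ℂ) * ((0 : ℂ) + m + 1) * sphmCoeffD m ν κ 1 =
      ((0 : ℂ) * (0 + 2 * m + 1) - ν - κ) * sphmCoeffD m ν κ 0 - sphmCoeff m ν κ 0 := by
  have hL := ((hasDerivAt_sphmCoeff m ν κ 1).const_mul (2 * (1 : ℂ) * ((0 : ℂ) + m + 1)))
  have hR : HasDerivAt (fun ν' ↦ ((0 : ℂ) * (0 + 2 * m + 1) - ν' - κ) * sphmCoeff m ν' κ 0)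
      ((0 - 1 - 0) * sphmCoeff m ν κ 0 + ((0 : ℂ) * (0 + 2 * m + 1) - ν - κ) * sphmCoeffD m ν κ 0) ν :=
    (((hasDerivAt_const ν _).sub (hasDerivAt_id ν)).sub (hasDerivAt_const ν κ)).mul (hasDerivAt_sphmCoeff m ν κ 0)
  have heq : (fun ν' ↦ 2 * (1 : ℂ) * ((0 : ℂ) + m + 1) * sphmCoeff m ν' κ 1) =
      fun ν' ↦ ((0 : ℂ) * (0 + 2 * m + 1) - ν' - κ) * sphmCoeff m ν' κ 0 :=
    funext fun ν' ↦ sphmCoeff_rec_zero m ν' κ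
  rw [heq] at hL
  have h := hL.unique hR
  linear_combination h

/-- The differentiated recursion, index `1`. [folklore] -/
theorem sphmCoeffD_rec_one (ν κ : ℂ) :
    2 * (2 : ℂ) * ((1 : ℂ) + m + 1) * sphmCoeffD m ν κ 2 =
      ((1 : ℂ) * (1 + 2 * m + 1) - ν - κ) * sphmCoeffD m ν κ 1 - sphmCoeff m ν κ 1 +
        2 * κ * sphmCoeffD m ν κ 0 := by
  have hL := ((hasDerivAt_sphmCoeff m ν κ 2).const_mul (2 * (2 : ℂ) * ((1 : ℂ) + m + 1)))
  have hR : HasDerivAt (fun ν' ↦ ((1 : ℂ) * (1 + 2 * m + 1) - ν' - κ) * sphmCoeff m ν' κ 1 + 2 * κ * sphmCoeff m ν' κ 0)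
      ((0 - 1 - 0) * sphmCoeff m ν κ 1 + ((1 : ℂ) * (1 + 2 * m + 1) - ν - κ) * sphmCoeffD m ν κ 1 +
        2 * κ * sphmCoeffD m ν κ 0) ν :=
    ((((hasDerivAt_const ν _).sub (hasDerivAt_id ν)).sub (hasDerivAt_const ν κ)).mul
      (hasDerivAt_sphmCoeff m ν κ 1)).add ((hasDerivAt_sphmCoeff m ν κ 0).const_mul _)
  have heq : (fun ν' ↦ 2 * (2 : ℂ) * ((1 : ℂ) + m + 1) * sphmCoeff m ν' κ 2) =
      fun ν' ↦ ((1 : ℂ) * (1 + 2 * m + 1) - ν' - κ) * sphmCoeff m ν' κ 1 + 2 * κ * sphmCoeff m ν' κ 0 :=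
    funext fun ν' ↦ sphmCoeff_rec_one m ν' κ
  rw [heq] at hL
  have h := hL.unique hR
  linear_combination h

/-- The differentiated recursion, index `k + 2`:
`2(k+3)(k+m+3) c'_{k+3} = ((k+2)(k+2m+3) − ν − κ) c'_{k+2} − c_{k+2} + 2κ c'_{k+1} − κ c'ₖ`. [folklore] -/
theorem sphmCoeffD_rec_add_two (ν κ : ℂ) (k : ℕ) :
    2 * ((k : ℂ) + 3) * (((k : ℂ) + 2) + m + 1) * sphmCoeffD m ν κ (k + 3) =
      (((k : ℂ) + 2) * ((k : ℂ) + 2 + 2 * m + 1) - ν - κ) * sphmCoeffD m ν κ (k + 2) - sphmCoeff m ν κ (k + 2) +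
        2 * κ * sphmCoeffD m ν κ (k + 1) - κ * sphmCoeffD m ν κ k := by
  have hL := ((hasDerivAt_sphmCoeff m ν κ (k + 3)).const_mul (2 * ((k : ℂ) + 3) * (((k : ℂ) + 2) + m + 1)))
  have hR : HasDerivAt (fun ν' ↦ (((k : ℂ) + 2) * ((k : ℂ) + 2 + 2 * m + 1) - ν' - κ) * sphmCoeff m ν' κ (k + 2) +
        2 * κ * sphmCoeff m ν' κ (k + 1) - κ * sphmCoeff m ν' κ k)
      ((0 - 1 - 0) * sphmCoeff m ν κ (k + 2) + (((k : ℂ) + 2) * ((k : ℂ) + 2 + 2 * m + 1) - ν - κ) * sphmCoeffD m ν κ (k + 2) +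
        2 * κ * sphmCoeffD m ν κ (k + 1) - κ * sphmCoeffD m ν κ k) ν :=
    (((((hasDerivAt_const ν _).sub (hasDerivAt_id ν)).sub (hasDerivAt_const ν κ)).mul
      (hasDerivAt_sphmCoeff m ν κ (k + 2))).add ((hasDerivAt_sphmCoeff m ν κ (k + 1)).const_mul _)).sub
      ((hasDerivAt_sphmCoeff m ν κ k).const_mul _)
  have heq : (fun ν' ↦ 2 * ((k : ℂ) + 3) * (((k : ℂ) + 2) + m + 1) * sphmCoeff m ν' κ (k + 3)) =
      fun ν' ↦ (((k : ℂ) + 2) * ((k : ℂ) + 2 + 2 * m + 1) - ν' - κ) * sphmCoeff m ν' κ (k + 2) +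
        2 * κ * sphmCoeff m ν' κ (k + 1) - κ * sphmCoeff m ν' κ k :=
    funext fun ν' ↦ sphmCoeff_rec_add_two m ν' κ k
  rw [heq] at hL
  have h := hL.unique hR
  linear_combination h

/-- **The operator kills the derivative coefficients up to the source `−a`**: with
`a'ₖ = c'ₖ (5/4)ᵏ` and `aₖ = cₖ (5/4)ᵏ`, `(L a')ₖ = −aₖ` for all `k`. [folklore] -/
theorem odeCoeffOf_coeffD (ν κ : ℂ) (k : ℕ) :
    odeCoeffOf m ν κ (fun j ↦ sphmCoeffD m ν κ j * (5 / 4) ^ j) k = -(sphmResc54 m ν κ k) := by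
  match k with
  | 0 =>
    rw [odeCoeffOf_resc_zero, sphmResc54, pow_zero, mul_one]
    linear_combination sphmCoeffD_rec_zero m ν κ
  | 1 =>
    rw [odeCoeffOf_resc_one, sphmResc54, pow_one]
    linear_combination (5 / 4 : ℂ) * sphmCoeffD_rec_one m ν κ
  | k + 2 =>
    rw [odeCoeffOf_resc, sphmResc54]
    linear_combination (5 / 4 : ℂ) ^ (k + 2) * sphmCoeffD_rec_add_two m ν κ k

end CoeffD

/-! ### The derivative series `∂q/∂ν` via the smooth dependence of the coefficient sequence -/

section DerivSeq

variable (m : ℕ) (ν κ : ℂ)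

/-- The admissible radius `R = ‖ν‖ + ‖κ‖ + 1` at `(ν, κ)`. [folklore] -/
def radAt (ν κ : ℂ) : ℝ := ‖ν‖ + ‖κ‖ + 1

/-- `(ν, κ)` lies in the open parameter disc of radius `radAt ν κ`. [folklore] -/
theorem mem_disc_radAt : ‖ν‖ + ‖κ‖ < radAt ν κ := by unfold radAt; linarith

/-- `0 ≤ radAt`. [folklore] -/
theorem radAt_nonneg : 0 ≤ radAt ν κ := by unfold radAt; positivity

/-- The evaluation coefficient sequence as a function of `ν` alone (at the radius adapted to the
base point `(ν₀, κ)`). [folklore] -/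
def evalSeqNu (m : ℕ) (ν₀ κ : ℂ) (ν : ℂ) : CSeq := sphmEvalSeq m (sphmN m (radAt ν₀ κ)) (ν, κ)

/-- `ν ↦ evalSeqNu m ν₀ κ ν` is smooth near `ν₀`. [folklore] -/
theorem contDiffAt_evalSeqNu {n : WithTop ℕ∞} : ContDiffAt ℂ n (evalSeqNu m ν κ) ν := by
  have hU : {p : ℂ × ℂ | ‖p.1‖ + ‖p.2‖ < radAt ν κ} ∈ 𝓝 (ν, κ) :=
    (isOpen_paramDisc _).mem_nhds (mem_disc_radAt ν κ)
  have h := (contDiffOn_sphmEvalSeq m (radAt ν κ) (radAt_nonneg ν κ) (n := n)).contDiffAt hU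
  exact h.comp ν (contDiffAt_id.prodMk contDiffAt_const)

/-- **The `ν`-derivative of the evaluation sequence** at `ν₀`, an element of `ℕ →ᵇ ℂ`. [folklore] -/
def evalSeqD (m : ℕ) (ν κ : ℂ) : CSeq := deriv (evalSeqNu m ν κ) ν

/-- `HasDerivAt (evalSeqNu m ν₀ κ) (evalSeqD m ν₀ κ) ν₀`. [folklore] -/
theorem hasDerivAt_evalSeqNu : HasDerivAt (evalSeqNu m ν κ) (evalSeqD m ν κ) ν :=
  ((contDiffAt_evalSeqNu m ν κ (n := 1)).differentiableAt one_ne_zero).hasDerivAt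

/-- Near `ν₀` the coordinates of the evaluation sequence are `cₖ(ν) (5/4)ᵏ`. [folklore] -/
theorem evalSeqNu_apply_eventually (k : ℕ) :
    ∀ᶠ ν' in 𝓝 ν, evalSeqNu m ν κ ν' k = sphmResc54 m ν' κ k := by
  have hO : IsOpen {ν' : ℂ | ‖ν'‖ + ‖κ‖ < radAt ν κ} := isOpen_lt (continuous_norm.add continuous_const) continuous_const
  filter_upwards [hO.mem_nhds (mem_disc_radAt ν κ)] with ν' hν'
  exact sphmEvalSeq_apply m (radAt_nonneg ν κ) (p := (ν', κ)) (le_of_lt hν') k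

/-- **The coordinates of the derivative sequence are the derivatives of the coordinates**:
`(evalSeqD m ν κ)ₖ = c'ₖ(ν) (5/4)ᵏ`. [folklore] -/
theorem evalSeqD_apply (k : ℕ) : evalSeqD m ν κ k = sphmCoeffD m ν κ k * (5 / 4) ^ k := by
  -- derivative of the coordinate through the continuous linear functional `πₖ`
  have h1 : HasDerivAt (fun ν' ↦ coordCLM k (evalSeqNu m ν κ ν')) (coordCLM k (evalSeqD m ν κ)) ν :=
    (coordCLM k).hasFDerivAt.comp_hasDerivAt ν (hasDerivAt_evalSeqNu m ν κ)
  simp only [coordCLM_apply] at h1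
  -- derivative of `cₖ(ν) (5/4)ᵏ` directly
  have h2 : HasDerivAt (fun ν' ↦ sphmResc54 m ν' κ k) (sphmCoeffD m ν κ k * (5 / 4) ^ k) ν :=
    (hasDerivAt_sphmCoeff m ν κ k).mul_const _
  have h1' : HasDerivAt (fun ν' ↦ sphmResc54 m ν' κ k) (evalSeqD m ν κ k) ν :=
    h1.congr_of_eventuallyEq ((evalSeqNu_apply_eventually m ν κ k).mono fun ν' h ↦ h.symm)
  exact h1'.unique h2

/-- The derivative coefficients, rescaled to the evaluation radius, are polynomially bounded
(indeed bounded). [folklore] -/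
theorem polyBounded_sphmCoeffD54 : PolyBounded (fun k ↦ sphmCoeffD m ν κ k * (5 / 4) ^ k) := by
  have h : (fun k ↦ sphmCoeffD m ν κ k * (5 / 4) ^ k) = ⇑(evalSeqD m ν κ) := funext fun k ↦ (evalSeqD_apply m ν κ k).symm
  rw [h]
  exact PolyBounded.of_cseq _

/-- **The `ν`-derivative series** `∂q/∂ν (t) = Σ c'ₖ tᵏ` (all `t`; converges on `‖t‖ < 5/4`).
[cite: ShlapentokhRothman2014KleinGordon, App. B] -/
def sphmFunD (m : ℕ) (ν κ : ℂ) (t : ℂ) : ℂ := ∑' k, sphmCoeffD m ν κ k * t ^ k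

/-- `∂q/∂ν` as a unit-disc series. [folklore] -/
theorem sphmFunD_eq_ser (t : ℂ) : sphmFunD m ν κ t = ser (fun k ↦ sphmCoeffD m ν κ k * (5 / 4) ^ k) t := by
  rw [sphmFunD, ser, cseries]
  refine tsum_congr fun k ↦ ?_
  rw [mul_pow, mul_assoc, ← mul_assoc ((5 / 4 : ℂ) ^ k), ← mul_pow]
  norm_num

/-- The `t`-derivative of `∂q/∂ν`. [folklore] -/
def sphmDerD (m : ℕ) (ν κ : ℂ) (t : ℂ) : ℂ := serD (fun k ↦ sphmCoeffD m ν κ k * (5 / 4) ^ k) t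

/-- The second `t`-derivative of `∂q/∂ν`. [folklore] -/
def sphmDer2D (m : ℕ) (ν κ : ℂ) (t : ℂ) : ℂ := serD2 (fun k ↦ sphmCoeffD m ν κ k * (5 / 4) ^ k) t

variable {m ν κ}

/-- `d/dt (∂q/∂ν) = sphmDerD` on `‖t‖ < 5/4`. [folklore] -/
theorem hasDerivAt_sphmFunD {t : ℂ} (ht : ‖t‖ < 5 / 4) : HasDerivAt (sphmFunD m ν κ) (sphmDerD m ν κ t) t := by
  have h := hasDerivAt_ser (polyBounded_sphmCoeffD54 m ν κ) ht
  rw [show sphmFunD m ν κ = ser (fun k ↦ sphmCoeffD m ν κ k * (5 / 4) ^ k) from funext (sphmFunD_eq_ser m ν κ)]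
  exact h

/-- `d/dt sphmDerD = sphmDer2D` on `‖t‖ < 5/4`. [folklore] -/
theorem hasDerivAt_sphmDerD {t : ℂ} (ht : ‖t‖ < 5 / 4) : HasDerivAt (sphmDerD m ν κ) (sphmDer2D m ν κ t) t :=
  hasDerivAt_serD (polyBounded_sphmCoeffD54 m ν κ) ht

/-- **`∂q/∂ν` is the `ν`-derivative of `q`**: for `‖t‖ < 5/4`,
`HasDerivAt (ν ↦ q(t; m, ν, κ)) (sphmFunD m ν₀ κ t) ν₀`. The proof differentiates
`ν ↦ evCLM 0 s (evalSeqNu ν)` through the continuous linear functional `evCLM 0 s`.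
[cite: ShlapentokhRothman2014KleinGordon, App. B] -/
theorem hasDerivAt_sphmFun_nu {t : ℂ} (ht : ‖t‖ < 5 / 4) :
    HasDerivAt (fun ν' ↦ sphmFun m ν' κ t) (sphmFunD m ν κ t) ν := by
  set s : ℂ := (4 / 5 : ℂ) * t with hs_def
  have hs : ‖s‖ < 1 := norm_rescale_lt ht
  have h1 : HasDerivAt (fun ν' ↦ evCLM 0 s (evalSeqNu m ν κ ν')) (evCLM 0 s (evalSeqD m ν κ)) ν :=
    (evCLM 0 s).hasFDerivAt.comp_hasDerivAt ν (hasDerivAt_evalSeqNu m ν κ)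
  have hval : evCLM 0 s (evalSeqD m ν κ) = sphmFunD m ν κ t := by
    rw [evCLM_zero_apply hs, sphmFunD_eq_ser, ser]
    exact cseries_congr (evalSeqD_apply m ν κ) _
  have hfun : (fun ν' ↦ evCLM 0 s (evalSeqNu m ν κ ν')) =ᶠ[𝓝 ν] fun ν' ↦ sphmFun m ν' κ t := by
    have hO : IsOpen {ν' : ℂ | ‖ν'‖ + ‖κ‖ < radAt ν κ} := isOpen_lt (continuous_norm.add continuous_const) continuous_const
    filter_upwards [hO.mem_nhds (mem_disc_radAt ν κ)] with ν' hν'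
    rw [evCLM_zero_apply hs, sphmFun_eq_cseries]
    exact cseries_congr (fun k ↦ sphmEvalSeq_apply m (radAt_nonneg ν κ) (p := (ν', κ)) (le_of_lt hν') k) _
  rw [← hval]
  exact h1.congr_of_eventuallyEq hfun.symm

/-- **`∂q'/∂ν` is the `t`-derivative of `∂q/∂ν`**: for `‖t‖ < 5/4`,
`HasDerivAt (ν ↦ q'(t; m, ν, κ)) (sphmDerD m ν₀ κ t) ν₀` (through `evCLM 1 s`). In particular the
`ν`-derivative of the shooting function `F(ν, κ) = q'(1; ν, κ)` is `sphmDerD m ν κ 1`.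
[cite: ShlapentokhRothman2014KleinGordon, App. B] -/
theorem hasDerivAt_sphmDer_nu {t : ℂ} (ht : ‖t‖ < 5 / 4) :
    HasDerivAt (fun ν' ↦ sphmDer m ν' κ t) (sphmDerD m ν κ t) ν := by
  set s : ℂ := (4 / 5 : ℂ) * t with hs_def
  have hs : ‖s‖ < 1 := norm_rescale_lt ht
  have h1 : HasDerivAt (fun ν' ↦ (4 / 5 : ℂ) * evCLM 1 s (evalSeqNu m ν κ ν')) ((4 / 5 : ℂ) * evCLM 1 s (evalSeqD m ν κ)) ν :=
    ((evCLM 1 s).hasFDerivAt.comp_hasDerivAt ν (hasDerivAt_evalSeqNu m ν κ)).const_mul _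
  have hval : (4 / 5 : ℂ) * evCLM 1 s (evalSeqD m ν κ) = sphmDerD m ν κ t := by
    rw [evCLM_one_apply hs, sphmDerD, serD]
    congr 1
    refine cseries_congr (fun k ↦ ?_) _
    rw [dSeq_apply, dSeq_apply, evalSeqD_apply m ν κ (k + 1)]
  have hfun : (fun ν' ↦ (4 / 5 : ℂ) * evCLM 1 s (evalSeqNu m ν κ ν')) =ᶠ[𝓝 ν] fun ν' ↦ sphmDer m ν' κ t := by
    have hO : IsOpen {ν' : ℂ | ‖ν'‖ + ‖κ‖ < radAt ν κ} := isOpen_lt (continuous_norm.add continuous_const) continuous_const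
    filter_upwards [hO.mem_nhds (mem_disc_radAt ν κ)] with ν' hν'
    rw [evCLM_one_apply hs, sphmDer]
    congr 1
    refine cseries_congr (fun k ↦ ?_) _
    rw [dSeq_apply, dSeq_apply, show evalSeqNu m ν κ ν' (k + 1) = sphmResc54 m ν' κ (k + 1) from
      sphmEvalSeq_apply m (radAt_nonneg ν κ) (p := (ν', κ)) (le_of_lt hν') (k + 1)]
  rw [← hval]
  exact h1.congr_of_eventuallyEq hfun.symm

/-- **The inhomogeneous equation for `∂q/∂ν`**: on `‖t‖ < 5/4`,
`t(2 − t) W'' + 2(m+1)(1 − t) W' + (ν + κ(1 − t)²) W = −q` (differentiate the equation for `q`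
in `ν`; at the level of coefficients this is the differentiated recursion, `odeCoeffOf_coeffD`).
[cite: ShlapentokhRothman2014KleinGordon, App. B] -/
theorem sphmFunD_ode {t : ℂ} (ht : ‖t‖ < 5 / 4) :
    t * (2 - t) * sphmDer2D m ν κ t + 2 * ((m : ℂ) + 1) * (1 - t) * sphmDerD m ν κ t +
      (ν + κ * (1 - t) ^ 2) * sphmFunD m ν κ t = -sphmFun m ν κ t := by
  have h := ser_ode_identity (m := m) (ν := ν) (κ := κ) (polyBounded_sphmCoeffD54 m ν κ) ht
  rw [sphmFunD_eq_ser, sphmDer2D, sphmDerD, h, ser, sphmFun_eq_cseries, ← cseries_neg]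
  exact cseries_congr (odeCoeffOf_coeffD m ν κ) _

end DerivSeq

/-! ### The latitude variable: the Lagrange identity and its integral over `[0, 1]` -/

section Lagrange

variable {m : ℕ} {ν κ : ℂ}

/-- The wide latitude interval `(−1/4, 9/4)` on which the pole solution `q(1 − x)` lives. [folklore] -/
theorem mem_wide_of_mem_Icc {x : ℝ} (hx : x ∈ Icc (0 : ℝ) 1) : x ∈ Ioo (-1 / 4 : ℝ) (9 / 4) :=
  ⟨by linarith [hx.1], by linarith [hx.2]⟩

/-- `u = q(1 − x)`: derivative `−q'(1 − x)` on the wide interval. [folklore] -/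
theorem hasDerivAt_u {x : ℝ} (hx : x ∈ Ioo (-1 / 4 : ℝ) (9 / 4)) :
    HasDerivAt (fun y : ℝ ↦ sphmFun m ν κ (1 - (y : ℂ))) (-sphmDer m ν κ (1 - (x : ℂ))) x := by
  have h := (hasDerivAt_sphmFun (m := m) (ν := ν) (κ := κ) (norm_one_sub_lt hx)).comp x (hasDerivAt_one_sub_ofReal x)
  simpa [Function.comp_def] using h

/-- `u' = −q'(1 − x)`: derivative `q''(1 − x)` on the wide interval. [folklore] -/
theorem hasDerivAt_u1 {x : ℝ} (hx : x ∈ Ioo (-1 / 4 : ℝ) (9 / 4)) :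
    HasDerivAt (fun y : ℝ ↦ -sphmDer m ν κ (1 - (y : ℂ))) (sphmDer2 m ν κ (1 - (x : ℂ))) x := by
  have h := ((hasDerivAt_sphmDer (m := m) (ν := ν) (κ := κ) (norm_one_sub_lt hx)).comp x
    (hasDerivAt_one_sub_ofReal x)).fun_neg
  simpa [Function.comp_def] using h

/-- `w = ∂q/∂ν (1 − x)`: derivative `−sphmDerD(1 − x)` on the wide interval. [folklore] -/
theorem hasDerivAt_w {x : ℝ} (hx : x ∈ Ioo (-1 / 4 : ℝ) (9 / 4)) :
    HasDerivAt (fun y : ℝ ↦ sphmFunD m ν κ (1 - (y : ℂ))) (-sphmDerD m ν κ (1 - (x : ℂ))) x := by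
  have h := (hasDerivAt_sphmFunD (m := m) (ν := ν) (κ := κ) (norm_one_sub_lt hx)).comp x (hasDerivAt_one_sub_ofReal x)
  simpa [Function.comp_def] using h

/-- `w' = −sphmDerD(1 − x)`: derivative `sphmDer2D(1 − x)` on the wide interval. [folklore] -/
theorem hasDerivAt_w1 {x : ℝ} (hx : x ∈ Ioo (-1 / 4 : ℝ) (9 / 4)) :
    HasDerivAt (fun y : ℝ ↦ -sphmDerD m ν κ (1 - (y : ℂ))) (sphmDer2D m ν κ (1 - (x : ℂ))) x := by
  have h := ((hasDerivAt_sphmDerD (m := m) (ν := ν) (κ := κ) (norm_one_sub_lt hx)).comp x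
    (hasDerivAt_one_sub_ofReal x)).fun_neg
  simpa [Function.comp_def] using h

/-- **The Lagrange quantity** `Φ(x) = (1 − x²)^{m+1} (u w' − u' w)`, `u = q(1 − x)`,
`w = ∂q/∂ν (1 − x)`. Hartman Ch. XI §2. [cite: Hartman2002, Ch. XI §2] -/
def lagrangePhi (m : ℕ) (ν κ : ℂ) (x : ℝ) : ℂ :=
  (1 - (x : ℂ) ^ 2) ^ (m + 1) *
    (sphmFun m ν κ (1 - (x : ℂ)) * (-sphmDerD m ν κ (1 - (x : ℂ))) -
      (-sphmDer m ν κ (1 - (x : ℂ))) * sphmFunD m ν κ (1 - (x : ℂ)))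

/-- **The Lagrange identity**: `Φ'(x) = −(1 − x²)^m u(x)²` on the wide interval (from the equation
for `u` and the inhomogeneous equation for `w = ∂u/∂ν`). Hartman Ch. XI §2 (2.2)–(2.3).
[cite: Hartman2002, Ch. XI §2] -/
theorem hasDerivAt_lagrangePhi {x : ℝ} (hx : x ∈ Ioo (-1 / 4 : ℝ) (9 / 4)) :
    HasDerivAt (lagrangePhi m ν κ) (-(1 - (x : ℂ) ^ 2) ^ m * sphmFun m ν κ (1 - (x : ℂ)) ^ 2) x := by
  have hs : ‖(1 : ℂ) - (x : ℂ)‖ < 5 / 4 := norm_one_sub_lt hx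
  -- the two equations at `t = 1 − x`
  have hU := sphmFun_ode (m := m) (ν := ν) (κ := κ) hs
  have hW := sphmFunD_ode (m := m) (ν := ν) (κ := κ) hs
  -- derivative of the weight
  have hP : HasDerivAt (fun y : ℝ ↦ (1 - (y : ℂ) ^ 2) ^ (m + 1))
      ((((m + 1 : ℕ) : ℂ)) * (1 - (x : ℂ) ^ 2) ^ (m + 1 - 1) * (-(2 * (x : ℂ)))) x := by
    have hc : HasDerivAt (fun y : ℝ ↦ (y : ℂ)) 1 x := (hasDerivAt_id' x).ofReal_comp
    have h1 : HasDerivAt (fun y : ℝ ↦ (1 : ℂ) - (y : ℂ) ^ 2) (-(2 * (x : ℂ))) x := by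
      have h := (hc.mul hc).const_sub (1 : ℂ)
      have hf : (fun y : ℝ ↦ (1 : ℂ) - (y : ℂ) ^ 2) = fun y : ℝ ↦ (1 : ℂ) - (y : ℂ) * (y : ℂ) := by
        funext y; ring
      rw [hf]
      refine h.congr_deriv ?_
      ring
    have h := (hasDerivAt_pow (m + 1) ((1 : ℂ) - (x : ℂ) ^ 2)).comp x h1
    exact h
  have hu := hasDerivAt_u (m := m) (ν := ν) (κ := κ) hx
  have hu1 := hasDerivAt_u1 (m := m) (ν := ν) (κ := κ) hx
  have hw := hasDerivAt_w (m := m) (ν := ν) (κ := κ) hx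
  have hw1 := hasDerivAt_w1 (m := m) (ν := ν) (κ := κ) hx
  have hprod := hP.fun_mul ((hu.fun_mul hw1).fun_sub (hu1.fun_mul hw))
  unfold lagrangePhi
  refine hprod.congr_deriv ?_
  simp only [Nat.add_sub_cancel]
  push_cast
  set X : ℂ := (x : ℂ)
  set U := sphmFun m ν κ (1 - X)
  set U1 := sphmDer m ν κ (1 - X)
  set U2 := sphmDer2 m ν κ (1 - X)
  set V := sphmFunD m ν κ (1 - X)
  set V1 := sphmDerD m ν κ (1 - X)
  set V2 := sphmDer2D m ν κ (1 - X)
  -- `hU : (1-X)(2-(1-X)) U2 + 2(m+1)(1-(1-X)) U1 + (ν + κ(1-(1-X))²) U = 0`, similarly `hW … = -U`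
  linear_combination (-((1 - X ^ 2) ^ m * V)) * hU + ((1 - X ^ 2) ^ m * U) * hW

/-- `u = q(1 − x)` is continuous on the wide interval. [folklore] -/
theorem continuousOn_u : ContinuousOn (fun y : ℝ ↦ sphmFun m ν κ (1 - (y : ℂ))) (Ioo (-1 / 4 : ℝ) (9 / 4)) :=
  fun _ hx ↦ (hasDerivAt_u (m := m) (ν := ν) (κ := κ) hx).continuousAt.continuousWithinAt

/-- **The integrated Lagrange identity at a zero of the shooting function**:
if `q'(1) = 0` then `q(1) · sphmDerD(1) = −∫₀¹ (1 − x²)^m q(1 − x)² dx`, i.e.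
`q(1) · ∂F/∂ν = −∫₀¹ (1 − x²)^m u²` (the weight `(1 − x²)^{m+1}` kills the boundary term at the
pole `x = 1`, and `u'(0) = −q'(1) = 0` kills half of the term at the equator). Hartman Ch. XI §2;
SR App. B. [cite: ShlapentokhRothman2014KleinGordon, App. B] -/
theorem sphmFun_one_mul_sphmDerD_one (hF : sphmDer m ν κ 1 = 0) :
    sphmFun m ν κ 1 * sphmDerD m ν κ 1 =
      -∫ x in (0 : ℝ)..1, (1 - (x : ℂ) ^ 2) ^ m * sphmFun m ν κ (1 - (x : ℂ)) ^ 2 := by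
  -- FTC for `Φ` on `[0, 1]`
  have hderiv : ∀ x ∈ uIcc (0 : ℝ) 1,
      HasDerivAt (lagrangePhi m ν κ) (-(1 - (x : ℂ) ^ 2) ^ m * sphmFun m ν κ (1 - (x : ℂ)) ^ 2) x := by
    intro x hx
    rw [uIcc_of_le zero_le_one] at hx
    exact hasDerivAt_lagrangePhi (mem_wide_of_mem_Icc hx)
  have hcont : ContinuousOn (fun x : ℝ ↦ -(1 - (x : ℂ) ^ 2) ^ m * sphmFun m ν κ (1 - (x : ℂ)) ^ 2) (uIcc (0 : ℝ) 1) := by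
    rw [uIcc_of_le zero_le_one]
    have hu : ContinuousOn (fun y : ℝ ↦ sphmFun m ν κ (1 - (y : ℂ))) (Icc (0 : ℝ) 1) :=
      continuousOn_u.mono fun x hx ↦ mem_wide_of_mem_Icc hx
    have hw : Continuous (fun y : ℝ ↦ -(1 - (y : ℂ) ^ 2) ^ m) := by fun_prop
    exact hw.continuousOn.mul (hu.pow 2)
  have hFTC := integral_eq_sub_of_hasDerivAt hderiv (hcont.intervalIntegrable)
  -- boundary values
  have h1 : lagrangePhi m ν κ 1 = 0 := by simp [lagrangePhi]
  have h0 : lagrangePhi m ν κ 0 = -(sphmFun m ν κ 1 * sphmDerD m ν κ 1) := by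
    simp only [lagrangePhi, Complex.ofReal_zero, sub_zero]
    rw [show (0 : ℂ) ^ 2 = 0 by norm_num, sub_zero, one_pow, one_mul, hF, neg_zero, zero_mul, sub_zero]
    ring
  rw [h1, h0] at hFTC
  have hneg : (fun y : ℝ ↦ -(1 - (y : ℂ) ^ 2) ^ m * sphmFun m ν κ (1 - (y : ℂ)) ^ 2) =
      fun y : ℝ ↦ -((1 - (y : ℂ) ^ 2) ^ m * sphmFun m ν κ (1 - (y : ℂ)) ^ 2) := by
    funext y; ring
  rw [hneg, intervalIntegral.integral_neg] at hFTC
  linear_combination -hFTC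

/-- **Positivity of the weighted square integral for real parameters**: for real `ν`, `κ` the
pole solution is real and `∫₀¹ (1 − x²)^m q(1 − x)² dx` is a positive real number (`q(0) = 1`).
[folklore] -/
theorem integral_weight_sq_pos (hν : ν.im = 0) (hκ : κ.im = 0) :
    ∃ I : ℝ, 0 < I ∧ ∫ x in (0 : ℝ)..1, (1 - (x : ℂ) ^ 2) ^ m * sphmFun m ν κ (1 - (x : ℂ)) ^ 2 = (I : ℂ) := by
  -- the real part `ur` of `u`
  set ur : ℝ → ℝ := fun x ↦ (sphmFun m ν κ (1 - (x : ℂ))).re with hur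
  have hreal : ∀ x ∈ Ioo (-1 / 4 : ℝ) (9 / 4), sphmFun m ν κ (1 - (x : ℂ)) = (ur x : ℂ) := by
    intro x hx
    have him : (sphmFun m ν κ (1 - (x : ℂ))).im = 0 := by
      rw [show (1 : ℂ) - (x : ℂ) = ((1 - x : ℝ) : ℂ) by push_cast; ring]
      refine im_sphmFun_ofReal (m := m) hν hκ ?_
      rw [abs_lt]; constructor <;> linarith [hx.1, hx.2]
    exact Complex.ext (by simp [hur]) (by simp [him])
  have hurc : ContinuousOn ur (Ioo (-1 / 4 : ℝ) (9 / 4)) := Complex.continuous_re.comp_continuousOn continuousOn_u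
  set g : ℝ → ℝ := fun x ↦ (1 - x ^ 2) ^ m * ur x ^ 2 with hg
  have hwc : Continuous (fun x : ℝ ↦ (1 - x ^ 2) ^ m) := by fun_prop
  have hgc : ContinuousOn g (Icc (0 : ℝ) 1) :=
    hwc.continuousOn.mul ((hurc.mono fun x hx ↦ mem_wide_of_mem_Icc hx).pow 2)
  have hg0 : ∀ x ∈ Icc (0 : ℝ) 1, 0 ≤ g x := fun x hx ↦ by
    have h1 : 0 ≤ 1 - x ^ 2 := by nlinarith [hx.1, hx.2]
    simp only [hg]; positivity
  -- a point near the pole where `g > 0`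
  obtain ⟨c, hcI, hgc0⟩ : ∃ c ∈ Icc (0 : ℝ) 1, 0 < g c := by
    have hcont1 : ContinuousAt ur 1 := hurc.continuousAt (Ioo_mem_nhds (by norm_num) (by norm_num))
    have hu1 : ur 1 = 1 := by simp [hur, sphmFun_zero]
    have hev : ∀ᶠ x in 𝓝 (1 : ℝ), 1 / 2 < ur x := hcont1.eventually (lt_mem_nhds (by rw [hu1]; norm_num))
    have hev' : ∀ᶠ x in 𝓝[<] (1 : ℝ), 1 / 2 < ur x ∧ x ∈ Ioo (1 / 2 : ℝ) 1 :=
      (hev.filter_mono nhdsWithin_le_nhds).and (Ioo_mem_nhdsLT (by norm_num))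
    obtain ⟨c, hc1, hc2⟩ := hev'.exists
    refine ⟨c, ⟨by linarith [hc2.1], hc2.2.le⟩, ?_⟩
    have h1 : 0 < 1 - c ^ 2 := by nlinarith [hc2.1, hc2.2]
    simp only [hg]
    have h2 : 0 < ur c := by linarith
    positivity
  refine ⟨∫ x in (0 : ℝ)..1, g x, ?_, ?_⟩
  · have h := integral_lt_integral_of_continuousOn_of_le_of_exists_lt zero_lt_one continuousOn_const hgc
      (fun x hx ↦ hg0 x (Ioc_subset_Icc_self hx)) ⟨c, hcI, hgc0⟩
    simpa using h
  · rw [← intervalIntegral.integral_ofReal]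
    refine integral_congr fun x hx ↦ ?_
    rw [uIcc_of_le zero_le_one] at hx
    simp only [hg, hreal x (mem_wide_of_mem_Icc hx)]
    push_cast
    ring

/-- **Non-degeneracy of real zeros of the shooting function.** For real `(ν₀, κ₀)` with
`F(ν₀, κ₀) = q'(1; m, ν₀, κ₀) = 0`: `∂F/∂ν (ν₀, κ₀) ≠ 0` (with `∂F/∂ν = sphmDerD m ν₀ κ₀ 1`,
`hasDerivAt_sphmDer_nu`) and `q(1; m, ν₀, κ₀) ≠ 0`, since their product is minus a positive
integral. This is the transversality making the real eigenvalue `λ = ν₀ + m(m+1)` the germ of a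
holomorphic eigenvalue curve `λ_{ml}(κ)` (implicit function theorem). SR, CMP 329 (2014), App. B.
[cite: ShlapentokhRothman2014KleinGordon, App. B] -/
theorem sphmDerD_one_ne_zero (hν : ν.im = 0) (hκ : κ.im = 0) (hF : sphmDer m ν κ 1 = 0) :
    sphmDerD m ν κ 1 ≠ 0 ∧ sphmFun m ν κ 1 ≠ 0 := by
  obtain ⟨I, hI, hint⟩ := integral_weight_sq_pos (m := m) hν hκ
  have h := sphmFun_one_mul_sphmDerD_one (m := m) hF
  rw [hint] at h
  have hne : sphmFun m ν κ 1 * sphmDerD m ν κ 1 ≠ 0 := by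
    rw [h, neg_ne_zero]
    exact_mod_cast hI.ne'
  exact ⟨right_ne_zero_of_mul hne, left_ne_zero_of_mul hne⟩

/-- The `deriv` form: `deriv (ν ↦ q'(1; m, ν, κ)) ν₀ ≠ 0` at a real zero. [cite: ShlapentokhRothman2014KleinGordon, App. B] -/
theorem deriv_shooting_ne_zero (hν : ν.im = 0) (hκ : κ.im = 0) (hF : sphmDer m ν κ 1 = 0) :
    deriv (fun ν' ↦ sphmDer m ν' κ 1) ν ≠ 0 := by
  rw [(hasDerivAt_sphmDer_nu (m := m) (ν := ν) (κ := κ) (by norm_num : ‖(1 : ℂ)‖ < 5 / 4)).deriv]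
  exact (sphmDerD_one_ne_zero hν hκ hF).1

/-- At a real zero of the shooting function, `q(1) ≠ 0` (so the even eigenfunction does not vanish
at the equator). [cite: ShlapentokhRothman2014KleinGordon, App. B] -/
theorem sphmFun_one_ne_zero (hν : ν.im = 0) (hκ : κ.im = 0) (hF : sphmDer m ν κ 1 = 0) :
    sphmFun m ν κ 1 ≠ 0 :=
  (sphmDerD_one_ne_zero hν hκ hF).2

end Lagrange

/-! ### The same for the spheroidicity parameter `κ`: `∂q/∂κ`, its equation with source `−(1−t)² q`,
and the ratio `∂F/∂κ : ∂F/∂ν ∈ (0, 1)` at real zeros -/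

section Kappa

variable (m : ℕ)

/-- **The `κ`-derivative of the Frobenius coefficient** `∂cₖ/∂κ`. [cite: ShlapentokhRothman2014KleinGordon, App. B] -/
def sphmCoeffK (m : ℕ) (ν κ : ℂ) (k : ℕ) : ℂ := deriv (fun κ' ↦ sphmCoeff m ν κ' k) κ

/-- `κ ↦ cₖ(m; ν, κ)` is differentiable with derivative `∂cₖ/∂κ`. [folklore] -/
theorem hasDerivAt_sphmCoeff_kappa (ν κ : ℂ) (k : ℕ) :
    HasDerivAt (fun κ' ↦ sphmCoeff m ν κ' k) (sphmCoeffK m ν κ k) κ := by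
  have hd : DifferentiableAt ℂ (fun κ' ↦ sphmCoeff m ν κ' k) κ :=
    ((contDiff_sphmCoeff m k (n := 1)).differentiable one_ne_zero).differentiableAt.comp κ
      ((differentiableAt_const ν).prodMk differentiableAt_id)
  exact hd.hasDerivAt

/-- `∂c₀/∂κ = 0`. [folklore] -/
@[simp] theorem sphmCoeffK_zero (ν κ : ℂ) : sphmCoeffK m ν κ 0 = 0 := by
  simp [sphmCoeffK]

/-- The `κ`-differentiated recursion, index `0`. [folklore] -/
theorem sphmCoeffK_rec_zero (ν κ : ℂ) :
    2 * (1 : ℂ) * ((0 : ℂ) + m + 1) * sphmCoeffK m ν κ 1 =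
      ((0 : ℂ) * (0 + 2 * m + 1) - ν - κ) * sphmCoeffK m ν κ 0 - sphmCoeff m ν κ 0 := by
  have hL := ((hasDerivAt_sphmCoeff_kappa m ν κ 1).const_mul (2 * (1 : ℂ) * ((0 : ℂ) + m + 1)))
  have hR : HasDerivAt (fun κ' ↦ ((0 : ℂ) * (0 + 2 * m + 1) - ν - κ') * sphmCoeff m ν κ' 0)
      ((0 - 0 - 1) * sphmCoeff m ν κ 0 + ((0 : ℂ) * (0 + 2 * m + 1) - ν - κ) * sphmCoeffK m ν κ 0) κ :=
    (((hasDerivAt_const κ _).sub (hasDerivAt_const κ ν)).sub (hasDerivAt_id κ)).mul (hasDerivAt_sphmCoeff_kappa m ν κ 0)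
  have heq : (fun κ' ↦ 2 * (1 : ℂ) * ((0 : ℂ) + m + 1) * sphmCoeff m ν κ' 1) =
      fun κ' ↦ ((0 : ℂ) * (0 + 2 * m + 1) - ν - κ') * sphmCoeff m ν κ' 0 :=
    funext fun κ' ↦ sphmCoeff_rec_zero m ν κ'
  rw [heq] at hL
  linear_combination hL.unique hR

/-- The `κ`-differentiated recursion, index `1`. [folklore] -/
theorem sphmCoeffK_rec_one (ν κ : ℂ) :
    2 * (2 : ℂ) * ((1 : ℂ) + m + 1) * sphmCoeffK m ν κ 2 =
      ((1 : ℂ) * (1 + 2 * m + 1) - ν - κ) * sphmCoeffK m ν κ 1 - sphmCoeff m ν κ 1 +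
        2 * κ * sphmCoeffK m ν κ 0 + 2 * sphmCoeff m ν κ 0 := by
  have hL := ((hasDerivAt_sphmCoeff_kappa m ν κ 2).const_mul (2 * (2 : ℂ) * ((1 : ℂ) + m + 1)))
  have hR : HasDerivAt (fun κ' ↦ ((1 : ℂ) * (1 + 2 * m + 1) - ν - κ') * sphmCoeff m ν κ' 1 + 2 * κ' * sphmCoeff m ν κ' 0)
      ((0 - 0 - 1) * sphmCoeff m ν κ 1 + ((1 : ℂ) * (1 + 2 * m + 1) - ν - κ) * sphmCoeffK m ν κ 1 +
        (2 * 1 * sphmCoeff m ν κ 0 + 2 * κ * sphmCoeffK m ν κ 0)) κ :=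
    ((((hasDerivAt_const κ _).sub (hasDerivAt_const κ ν)).sub (hasDerivAt_id κ)).mul
      (hasDerivAt_sphmCoeff_kappa m ν κ 1)).add (((hasDerivAt_id κ).const_mul (2 : ℂ)).mul (hasDerivAt_sphmCoeff_kappa m ν κ 0))
  have heq : (fun κ' ↦ 2 * (2 : ℂ) * ((1 : ℂ) + m + 1) * sphmCoeff m ν κ' 2) =
      fun κ' ↦ ((1 : ℂ) * (1 + 2 * m + 1) - ν - κ') * sphmCoeff m ν κ' 1 + 2 * κ' * sphmCoeff m ν κ' 0 :=
    funext fun κ' ↦ sphmCoeff_rec_one m ν κ'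
  rw [heq] at hL
  linear_combination hL.unique hR

/-- The `κ`-differentiated recursion, index `k + 2`:
`2(k+3)(k+m+3) ∂c_{k+3} = ((k+2)(k+2m+3) − ν − κ) ∂c_{k+2} − c_{k+2} + 2κ ∂c_{k+1} + 2c_{k+1} − κ ∂cₖ − cₖ`.
[folklore] -/
theorem sphmCoeffK_rec_add_two (ν κ : ℂ) (k : ℕ) :
    2 * ((k : ℂ) + 3) * (((k : ℂ) + 2) + m + 1) * sphmCoeffK m ν κ (k + 3) =
      (((k : ℂ) + 2) * ((k : ℂ) + 2 + 2 * m + 1) - ν - κ) * sphmCoeffK m ν κ (k + 2) - sphmCoeff m ν κ (k + 2) +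
        2 * κ * sphmCoeffK m ν κ (k + 1) + 2 * sphmCoeff m ν κ (k + 1) - κ * sphmCoeffK m ν κ k - sphmCoeff m ν κ k := by
  have hL := ((hasDerivAt_sphmCoeff_kappa m ν κ (k + 3)).const_mul (2 * ((k : ℂ) + 3) * (((k : ℂ) + 2) + m + 1)))
  have hR : HasDerivAt (fun κ' ↦ (((k : ℂ) + 2) * ((k : ℂ) + 2 + 2 * m + 1) - ν - κ') * sphmCoeff m ν κ' (k + 2) +
        2 * κ' * sphmCoeff m ν κ' (k + 1) - κ' * sphmCoeff m ν κ' k)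
      ((0 - 0 - 1) * sphmCoeff m ν κ (k + 2) + (((k : ℂ) + 2) * ((k : ℂ) + 2 + 2 * m + 1) - ν - κ) * sphmCoeffK m ν κ (k + 2) +
        (2 * 1 * sphmCoeff m ν κ (k + 1) + 2 * κ * sphmCoeffK m ν κ (k + 1)) -
        (1 * sphmCoeff m ν κ k + κ * sphmCoeffK m ν κ k)) κ :=
    (((((hasDerivAt_const κ _).sub (hasDerivAt_const κ ν)).sub (hasDerivAt_id κ)).mul
      (hasDerivAt_sphmCoeff_kappa m ν κ (k + 2))).add
      (((hasDerivAt_id κ).const_mul (2 : ℂ)).mul (hasDerivAt_sphmCoeff_kappa m ν κ (k + 1)))).sub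
      ((hasDerivAt_id κ).mul (hasDerivAt_sphmCoeff_kappa m ν κ k))
  have heq : (fun κ' ↦ 2 * ((k : ℂ) + 3) * (((k : ℂ) + 2) + m + 1) * sphmCoeff m ν κ' (k + 3)) =
      fun κ' ↦ (((k : ℂ) + 2) * ((k : ℂ) + 2 + 2 * m + 1) - ν - κ') * sphmCoeff m ν κ' (k + 2) +
        2 * κ' * sphmCoeff m ν κ' (k + 1) - κ' * sphmCoeff m ν κ' k :=
    funext fun κ' ↦ sphmCoeff_rec_add_two m ν κ' k
  rw [heq] at hL
  linear_combination hL.unique hR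

/-- **The operator on the `κ`-derivative coefficients**: with `∂aₖ = ∂cₖ (5/4)ᵏ`,
`(L ∂a)ₖ = −aₖ + (5/2) (S a)ₖ − (25/16) (S² a)ₖ` (source `−(1 − t)² q`). [folklore] -/
theorem odeCoeffOf_coeffK (ν κ : ℂ) (k : ℕ) :
    odeCoeffOf m ν κ (fun j ↦ sphmCoeffK m ν κ j * (5 / 4) ^ j) k =
      -(sphmResc54 m ν κ k) + 5 / 2 * shiftSeq (sphmResc54 m ν κ) k - 25 / 16 * shiftSeq (shiftSeq (sphmResc54 m ν κ)) k := by
  match k with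
  | 0 =>
    rw [odeCoeffOf_resc_zero, sphmResc54, shiftSeq_zero, shiftSeq_zero, pow_zero, mul_one]
    linear_combination sphmCoeffK_rec_zero m ν κ
  | 1 =>
    rw [odeCoeffOf_resc_one, sphmResc54, shiftSeq_succ, sphmResc54, shiftSeq_succ, shiftSeq_zero, pow_one, pow_zero]
    linear_combination (5 / 4 : ℂ) * sphmCoeffK_rec_one m ν κ
  | k + 2 =>
    rw [odeCoeffOf_resc, sphmResc54, shiftSeq_succ, sphmResc54, shiftSeq_succ, shiftSeq_succ, sphmResc54]
    linear_combination (5 / 4 : ℂ) ^ (k + 2) * sphmCoeffK_rec_add_two m ν κ k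

variable (ν κ : ℂ)

/-- The evaluation coefficient sequence as a function of `κ` alone. [folklore] -/
def evalSeqKappa (m : ℕ) (ν κ₀ : ℂ) (κ : ℂ) : CSeq := sphmEvalSeq m (sphmN m (radAt ν κ₀)) (ν, κ)

/-- `κ ↦ evalSeqKappa m ν κ₀ κ` is smooth near `κ₀`. [folklore] -/
theorem contDiffAt_evalSeqKappa {n : WithTop ℕ∞} : ContDiffAt ℂ n (evalSeqKappa m ν κ) κ := by
  have hU : {p : ℂ × ℂ | ‖p.1‖ + ‖p.2‖ < radAt ν κ} ∈ 𝓝 (ν, κ) :=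
    (isOpen_paramDisc _).mem_nhds (mem_disc_radAt ν κ)
  have h := (contDiffOn_sphmEvalSeq m (radAt ν κ) (radAt_nonneg ν κ) (n := n)).contDiffAt hU
  exact h.comp κ (contDiffAt_const.prodMk contDiffAt_id)

/-- The `κ`-derivative of the evaluation sequence. [folklore] -/
def evalSeqDK (m : ℕ) (ν κ : ℂ) : CSeq := deriv (evalSeqKappa m ν κ) κ

/-- `HasDerivAt (evalSeqKappa m ν κ₀) (evalSeqDK m ν κ₀) κ₀`. [folklore] -/
theorem hasDerivAt_evalSeqKappa : HasDerivAt (evalSeqKappa m ν κ) (evalSeqDK m ν κ) κ :=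
  ((contDiffAt_evalSeqKappa m ν κ (n := 1)).differentiableAt one_ne_zero).hasDerivAt

/-- Near `κ₀` the coordinates are `cₖ(κ) (5/4)ᵏ`. [folklore] -/
theorem evalSeqKappa_apply_eventually (k : ℕ) :
    ∀ᶠ κ' in 𝓝 κ, evalSeqKappa m ν κ κ' k = sphmResc54 m ν κ' k := by
  have hO : IsOpen {κ' : ℂ | ‖ν‖ + ‖κ'‖ < radAt ν κ} := isOpen_lt (continuous_const.add continuous_norm) continuous_const
  filter_upwards [hO.mem_nhds (mem_disc_radAt ν κ)] with κ' hκ'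
  exact sphmEvalSeq_apply m (radAt_nonneg ν κ) (p := (ν, κ')) (le_of_lt hκ') k

/-- The coordinates of the `κ`-derivative sequence: `(evalSeqDK)ₖ = ∂cₖ/∂κ (5/4)ᵏ`. [folklore] -/
theorem evalSeqDK_apply (k : ℕ) : evalSeqDK m ν κ k = sphmCoeffK m ν κ k * (5 / 4) ^ k := by
  have h1 : HasDerivAt (fun κ' ↦ coordCLM k (evalSeqKappa m ν κ κ')) (coordCLM k (evalSeqDK m ν κ)) κ :=
    (coordCLM k).hasFDerivAt.comp_hasDerivAt κ (hasDerivAt_evalSeqKappa m ν κ)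
  simp only [coordCLM_apply] at h1
  have h2 : HasDerivAt (fun κ' ↦ sphmResc54 m ν κ' k) (sphmCoeffK m ν κ k * (5 / 4) ^ k) κ :=
    (hasDerivAt_sphmCoeff_kappa m ν κ k).mul_const _
  have h1' : HasDerivAt (fun κ' ↦ sphmResc54 m ν κ' k) (evalSeqDK m ν κ k) κ :=
    h1.congr_of_eventuallyEq ((evalSeqKappa_apply_eventually m ν κ k).mono fun κ' h ↦ h.symm)
  exact h1'.unique h2

/-- The `κ`-derivative coefficients, rescaled, are polynomially bounded. [folklore] -/
theorem polyBounded_sphmCoeffK54 : PolyBounded (fun k ↦ sphmCoeffK m ν κ k * (5 / 4) ^ k) := by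
  have h : (fun k ↦ sphmCoeffK m ν κ k * (5 / 4) ^ k) = ⇑(evalSeqDK m ν κ) := funext fun k ↦ (evalSeqDK_apply m ν κ k).symm
  rw [h]
  exact PolyBounded.of_cseq _

/-- **The `κ`-derivative series** `∂q/∂κ (t) = Σ ∂cₖ tᵏ`. [cite: ShlapentokhRothman2014KleinGordon, App. B] -/
def sphmFunK (m : ℕ) (ν κ : ℂ) (t : ℂ) : ℂ := ∑' k, sphmCoeffK m ν κ k * t ^ k

/-- `∂q/∂κ` as a unit-disc series. [folklore] -/
theorem sphmFunK_eq_ser (t : ℂ) : sphmFunK m ν κ t = ser (fun k ↦ sphmCoeffK m ν κ k * (5 / 4) ^ k) t := by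
  rw [sphmFunK, ser, cseries]
  refine tsum_congr fun k ↦ ?_
  rw [mul_pow, mul_assoc, ← mul_assoc ((5 / 4 : ℂ) ^ k), ← mul_pow]
  norm_num

/-- The `t`-derivative of `∂q/∂κ`. [folklore] -/
def sphmDerK (m : ℕ) (ν κ : ℂ) (t : ℂ) : ℂ := serD (fun k ↦ sphmCoeffK m ν κ k * (5 / 4) ^ k) t

/-- The second `t`-derivative of `∂q/∂κ`. [folklore] -/
def sphmDer2K (m : ℕ) (ν κ : ℂ) (t : ℂ) : ℂ := serD2 (fun k ↦ sphmCoeffK m ν κ k * (5 / 4) ^ k) t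

variable {m ν κ}

/-- `d/dt (∂q/∂κ) = sphmDerK`. [folklore] -/
theorem hasDerivAt_sphmFunK {t : ℂ} (ht : ‖t‖ < 5 / 4) : HasDerivAt (sphmFunK m ν κ) (sphmDerK m ν κ t) t := by
  have h := hasDerivAt_ser (polyBounded_sphmCoeffK54 m ν κ) ht
  rw [show sphmFunK m ν κ = ser (fun k ↦ sphmCoeffK m ν κ k * (5 / 4) ^ k) from funext (sphmFunK_eq_ser m ν κ)]
  exact h

/-- `d/dt sphmDerK = sphmDer2K`. [folklore] -/
theorem hasDerivAt_sphmDerK {t : ℂ} (ht : ‖t‖ < 5 / 4) : HasDerivAt (sphmDerK m ν κ) (sphmDer2K m ν κ t) t :=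
  hasDerivAt_serD (polyBounded_sphmCoeffK54 m ν κ) ht

/-- **`∂q/∂κ` is the `κ`-derivative of `q`** on `‖t‖ < 5/4`. [cite: ShlapentokhRothman2014KleinGordon, App. B] -/
theorem hasDerivAt_sphmFun_kappa {t : ℂ} (ht : ‖t‖ < 5 / 4) :
    HasDerivAt (fun κ' ↦ sphmFun m ν κ' t) (sphmFunK m ν κ t) κ := by
  set s : ℂ := (4 / 5 : ℂ) * t with hs_def
  have hs : ‖s‖ < 1 := norm_rescale_lt ht
  have h1 : HasDerivAt (fun κ' ↦ evCLM 0 s (evalSeqKappa m ν κ κ')) (evCLM 0 s (evalSeqDK m ν κ)) κ :=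
    (evCLM 0 s).hasFDerivAt.comp_hasDerivAt κ (hasDerivAt_evalSeqKappa m ν κ)
  have hval : evCLM 0 s (evalSeqDK m ν κ) = sphmFunK m ν κ t := by
    rw [evCLM_zero_apply hs, sphmFunK_eq_ser, ser]
    exact cseries_congr (evalSeqDK_apply m ν κ) _
  have hfun : (fun κ' ↦ evCLM 0 s (evalSeqKappa m ν κ κ')) =ᶠ[𝓝 κ] fun κ' ↦ sphmFun m ν κ' t := by
    have hO : IsOpen {κ' : ℂ | ‖ν‖ + ‖κ'‖ < radAt ν κ} := isOpen_lt (continuous_const.add continuous_norm) continuous_const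
    filter_upwards [hO.mem_nhds (mem_disc_radAt ν κ)] with κ' hκ'
    rw [evCLM_zero_apply hs, sphmFun_eq_cseries]
    exact cseries_congr (fun k ↦ sphmEvalSeq_apply m (radAt_nonneg ν κ) (p := (ν, κ')) (le_of_lt hκ') k) _
  rw [← hval]
  exact h1.congr_of_eventuallyEq hfun.symm

/-- **`∂q'/∂κ` is the `t`-derivative of `∂q/∂κ`** on `‖t‖ < 5/4`; in particular the `κ`-derivative
of the shooting function is `sphmDerK m ν κ 1`. [cite: ShlapentokhRothman2014KleinGordon, App. B] -/
theorem hasDerivAt_sphmDer_kappa {t : ℂ} (ht : ‖t‖ < 5 / 4) :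
    HasDerivAt (fun κ' ↦ sphmDer m ν κ' t) (sphmDerK m ν κ t) κ := by
  set s : ℂ := (4 / 5 : ℂ) * t with hs_def
  have hs : ‖s‖ < 1 := norm_rescale_lt ht
  have h1 : HasDerivAt (fun κ' ↦ (4 / 5 : ℂ) * evCLM 1 s (evalSeqKappa m ν κ κ')) ((4 / 5 : ℂ) * evCLM 1 s (evalSeqDK m ν κ)) κ :=
    ((evCLM 1 s).hasFDerivAt.comp_hasDerivAt κ (hasDerivAt_evalSeqKappa m ν κ)).const_mul _
  have hval : (4 / 5 : ℂ) * evCLM 1 s (evalSeqDK m ν κ) = sphmDerK m ν κ t := by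
    rw [evCLM_one_apply hs, sphmDerK, serD]
    congr 1
    refine cseries_congr (fun k ↦ ?_) _
    rw [dSeq_apply, dSeq_apply, evalSeqDK_apply m ν κ (k + 1)]
  have hfun : (fun κ' ↦ (4 / 5 : ℂ) * evCLM 1 s (evalSeqKappa m ν κ κ')) =ᶠ[𝓝 κ] fun κ' ↦ sphmDer m ν κ' t := by
    have hO : IsOpen {κ' : ℂ | ‖ν‖ + ‖κ'‖ < radAt ν κ} := isOpen_lt (continuous_const.add continuous_norm) continuous_const
    filter_upwards [hO.mem_nhds (mem_disc_radAt ν κ)] with κ' hκ'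
    rw [evCLM_one_apply hs, sphmDer]
    congr 1
    refine cseries_congr (fun k ↦ ?_) _
    rw [dSeq_apply, dSeq_apply, show evalSeqKappa m ν κ κ' (k + 1) = sphmResc54 m ν κ' (k + 1) from
      sphmEvalSeq_apply m (radAt_nonneg ν κ) (p := (ν, κ')) (le_of_lt hκ') (k + 1)]
  rw [← hval]
  exact h1.congr_of_eventuallyEq hfun.symm

/-- **The inhomogeneous equation for `∂q/∂κ`**: on `‖t‖ < 5/4`,
`t(2 − t) W'' + 2(m+1)(1 − t) W' + (ν + κ(1 − t)²) W = −(1 − t)² q`.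
[cite: ShlapentokhRothman2014KleinGordon, App. B] -/
theorem sphmFunK_ode {t : ℂ} (ht : ‖t‖ < 5 / 4) :
    t * (2 - t) * sphmDer2K m ν κ t + 2 * ((m : ℂ) + 1) * (1 - t) * sphmDerK m ν κ t +
      (ν + κ * (1 - t) ^ 2) * sphmFunK m ν κ t = -(1 - t) ^ 2 * sphmFun m ν κ t := by
  have h := ser_ode_identity (m := m) (ν := ν) (κ := κ) (polyBounded_sphmCoeffK54 m ν κ) ht
  have hs : ‖(4 / 5 : ℂ) * t‖ < 1 := norm_rescale_lt ht
  have ha : PolyBounded (sphmResc54 m ν κ) := polyBounded_sphmResc54 m ν κ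
  rw [sphmFunK_eq_ser, sphmDer2K, sphmDerK, h, ser, cseries_congr (odeCoeffOf_coeffK m ν κ), sphmFun_eq_cseries]
  have p1 : PolyBounded (fun k ↦ -sphmResc54 m ν κ k) := ha.neg
  have p2 : PolyBounded (fun k ↦ 5 / 2 * shiftSeq (sphmResc54 m ν κ) k) := ha.shift.const_mul _
  have p3 : PolyBounded (fun k ↦ 25 / 16 * shiftSeq (shiftSeq (sphmResc54 m ν κ)) k) := ha.shift.shift.const_mul _
  rw [cseries_sub (p1.add p2) p3 hs, cseries_add p1 p2 hs, cseries_neg, cseries_const_mul, cseries_const_mul,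
    cseries_shiftSeq ha.shift hs, cseries_shiftSeq ha hs]
  ring

/-- The Lagrange quantity for the `κ`-variation: `Ψ(x) = (1 − x²)^{m+1}(u w' − u' w)`, `w = ∂u/∂κ`.
[cite: Hartman2002, Ch. XI §2] -/
def lagrangePhiK (m : ℕ) (ν κ : ℂ) (x : ℝ) : ℂ :=
  (1 - (x : ℂ) ^ 2) ^ (m + 1) *
    (sphmFun m ν κ (1 - (x : ℂ)) * (-sphmDerK m ν κ (1 - (x : ℂ))) -
      (-sphmDer m ν κ (1 - (x : ℂ))) * sphmFunK m ν κ (1 - (x : ℂ)))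

/-- `w = ∂q/∂κ (1 − x)` and `w'` in the latitude variable. [folklore] -/
theorem hasDerivAt_wK {x : ℝ} (hx : x ∈ Ioo (-1 / 4 : ℝ) (9 / 4)) :
    HasDerivAt (fun y : ℝ ↦ sphmFunK m ν κ (1 - (y : ℂ))) (-sphmDerK m ν κ (1 - (x : ℂ))) x := by
  have h := (hasDerivAt_sphmFunK (m := m) (ν := ν) (κ := κ) (norm_one_sub_lt hx)).comp x (hasDerivAt_one_sub_ofReal x)
  simpa [Function.comp_def] using h

/-- See `hasDerivAt_wK`. [folklore] -/
theorem hasDerivAt_wK1 {x : ℝ} (hx : x ∈ Ioo (-1 / 4 : ℝ) (9 / 4)) :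
    HasDerivAt (fun y : ℝ ↦ -sphmDerK m ν κ (1 - (y : ℂ))) (sphmDer2K m ν κ (1 - (x : ℂ))) x := by
  have h := ((hasDerivAt_sphmDerK (m := m) (ν := ν) (κ := κ) (norm_one_sub_lt hx)).comp x
    (hasDerivAt_one_sub_ofReal x)).fun_neg
  simpa [Function.comp_def] using h

/-- **The Lagrange identity for the `κ`-variation**: `Ψ'(x) = −x²(1 − x²)^m u(x)²`.
[cite: Hartman2002, Ch. XI §2] -/
theorem hasDerivAt_lagrangePhiK {x : ℝ} (hx : x ∈ Ioo (-1 / 4 : ℝ) (9 / 4)) :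
    HasDerivAt (lagrangePhiK m ν κ) (-(x : ℂ) ^ 2 * (1 - (x : ℂ) ^ 2) ^ m * sphmFun m ν κ (1 - (x : ℂ)) ^ 2) x := by
  have hs : ‖(1 : ℂ) - (x : ℂ)‖ < 5 / 4 := norm_one_sub_lt hx
  have hU := sphmFun_ode (m := m) (ν := ν) (κ := κ) hs
  have hW := sphmFunK_ode (m := m) (ν := ν) (κ := κ) hs
  have hP : HasDerivAt (fun y : ℝ ↦ (1 - (y : ℂ) ^ 2) ^ (m + 1))
      ((((m + 1 : ℕ) : ℂ)) * (1 - (x : ℂ) ^ 2) ^ (m + 1 - 1) * (-(2 * (x : ℂ)))) x := by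
    have hc : HasDerivAt (fun y : ℝ ↦ (y : ℂ)) 1 x := (hasDerivAt_id' x).ofReal_comp
    have h1 : HasDerivAt (fun y : ℝ ↦ (1 : ℂ) - (y : ℂ) ^ 2) (-(2 * (x : ℂ))) x := by
      have h := (hc.mul hc).const_sub (1 : ℂ)
      have hf : (fun y : ℝ ↦ (1 : ℂ) - (y : ℂ) ^ 2) = fun y : ℝ ↦ (1 : ℂ) - (y : ℂ) * (y : ℂ) := by
        funext y; ring
      rw [hf]
      refine h.congr_deriv ?_
      ring
    exact (hasDerivAt_pow (m + 1) ((1 : ℂ) - (x : ℂ) ^ 2)).comp x h1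
  have hu := hasDerivAt_u (m := m) (ν := ν) (κ := κ) hx
  have hu1 := hasDerivAt_u1 (m := m) (ν := ν) (κ := κ) hx
  have hw := hasDerivAt_wK (m := m) (ν := ν) (κ := κ) hx
  have hw1 := hasDerivAt_wK1 (m := m) (ν := ν) (κ := κ) hx
  have hprod := hP.fun_mul ((hu.fun_mul hw1).fun_sub (hu1.fun_mul hw))
  unfold lagrangePhiK
  refine hprod.congr_deriv ?_
  simp only [Nat.add_sub_cancel]
  push_cast
  set X : ℂ := (x : ℂ)
  set U := sphmFun m ν κ (1 - X)
  set U1 := sphmDer m ν κ (1 - X)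
  set U2 := sphmDer2 m ν κ (1 - X)
  set V := sphmFunK m ν κ (1 - X)
  set V1 := sphmDerK m ν κ (1 - X)
  set V2 := sphmDer2K m ν κ (1 - X)
  linear_combination (-((1 - X ^ 2) ^ m * V)) * hU + ((1 - X ^ 2) ^ m * U) * hW

/-- **The integrated identity for the `κ`-variation at a zero of the shooting function**:
`q(1) · sphmDerK(1) = −∫₀¹ x²(1 − x²)^m q(1 − x)² dx`. [cite: ShlapentokhRothman2014KleinGordon, App. B] -/
theorem sphmFun_one_mul_sphmDerK_one (hF : sphmDer m ν κ 1 = 0) :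
    sphmFun m ν κ 1 * sphmDerK m ν κ 1 =
      -∫ x in (0 : ℝ)..1, (x : ℂ) ^ 2 * (1 - (x : ℂ) ^ 2) ^ m * sphmFun m ν κ (1 - (x : ℂ)) ^ 2 := by
  have hderiv : ∀ x ∈ uIcc (0 : ℝ) 1,
      HasDerivAt (lagrangePhiK m ν κ) (-(x : ℂ) ^ 2 * (1 - (x : ℂ) ^ 2) ^ m * sphmFun m ν κ (1 - (x : ℂ)) ^ 2) x := by
    intro x hx
    rw [uIcc_of_le zero_le_one] at hx
    exact hasDerivAt_lagrangePhiK (mem_wide_of_mem_Icc hx)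
  have hcont : ContinuousOn (fun x : ℝ ↦ -(x : ℂ) ^ 2 * (1 - (x : ℂ) ^ 2) ^ m * sphmFun m ν κ (1 - (x : ℂ)) ^ 2)
      (uIcc (0 : ℝ) 1) := by
    rw [uIcc_of_le zero_le_one]
    have hu : ContinuousOn (fun y : ℝ ↦ sphmFun m ν κ (1 - (y : ℂ))) (Icc (0 : ℝ) 1) :=
      continuousOn_u.mono fun x hx ↦ mem_wide_of_mem_Icc hx
    have hw : Continuous (fun y : ℝ ↦ -(y : ℂ) ^ 2 * (1 - (y : ℂ) ^ 2) ^ m) := by fun_prop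
    exact hw.continuousOn.mul (hu.pow 2)
  have hFTC := integral_eq_sub_of_hasDerivAt hderiv (hcont.intervalIntegrable)
  have h1 : lagrangePhiK m ν κ 1 = 0 := by simp [lagrangePhiK]
  have h0 : lagrangePhiK m ν κ 0 = -(sphmFun m ν κ 1 * sphmDerK m ν κ 1) := by
    simp only [lagrangePhiK, Complex.ofReal_zero, sub_zero]
    rw [show (0 : ℂ) ^ 2 = 0 by norm_num, sub_zero, one_pow, one_mul, hF, neg_zero, zero_mul, sub_zero]
    ring
  rw [h1, h0] at hFTC
  have hneg : (fun y : ℝ ↦ -(y : ℂ) ^ 2 * (1 - (y : ℂ) ^ 2) ^ m * sphmFun m ν κ (1 - (y : ℂ)) ^ 2) =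
      fun y : ℝ ↦ -((y : ℂ) ^ 2 * (1 - (y : ℂ) ^ 2) ^ m * sphmFun m ν κ (1 - (y : ℂ)) ^ 2) := by
    funext y; ring
  rw [hneg, intervalIntegral.integral_neg] at hFTC
  linear_combination -hFTC

/-- **The two weighted square integrals for real parameters**: there are reals `0 < J < I` with
`∫₀¹ (1 − x²)^m u² = I` and `∫₀¹ x²(1 − x²)^m u² = J` (`u = q(1 − x)` is real, `x² < 1` on `(0, 1)`).
[folklore] -/
theorem integral_weights_sq_pos_lt (hν : ν.im = 0) (hκ : κ.im = 0) :
    ∃ I J : ℝ, 0 < J ∧ J < I ∧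
      ∫ x in (0 : ℝ)..1, (1 - (x : ℂ) ^ 2) ^ m * sphmFun m ν κ (1 - (x : ℂ)) ^ 2 = (I : ℂ) ∧
      ∫ x in (0 : ℝ)..1, (x : ℂ) ^ 2 * (1 - (x : ℂ) ^ 2) ^ m * sphmFun m ν κ (1 - (x : ℂ)) ^ 2 = (J : ℂ) := by
  set ur : ℝ → ℝ := fun x ↦ (sphmFun m ν κ (1 - (x : ℂ))).re with hur
  have hreal : ∀ x ∈ Ioo (-1 / 4 : ℝ) (9 / 4), sphmFun m ν κ (1 - (x : ℂ)) = (ur x : ℂ) := by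
    intro x hx
    have him : (sphmFun m ν κ (1 - (x : ℂ))).im = 0 := by
      rw [show (1 : ℂ) - (x : ℂ) = ((1 - x : ℝ) : ℂ) by push_cast; ring]
      refine im_sphmFun_ofReal (m := m) hν hκ ?_
      rw [abs_lt]; constructor <;> linarith [hx.1, hx.2]
    exact Complex.ext (by simp [hur]) (by simp [him])
  have hurc : ContinuousOn ur (Ioo (-1 / 4 : ℝ) (9 / 4)) := Complex.continuous_re.comp_continuousOn continuousOn_u
  set g : ℝ → ℝ := fun x ↦ (1 - x ^ 2) ^ m * ur x ^ 2 with hg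
  set h : ℝ → ℝ := fun x ↦ x ^ 2 * ((1 - x ^ 2) ^ m * ur x ^ 2) with hh
  have hwc : Continuous (fun x : ℝ ↦ (1 - x ^ 2) ^ m) := by fun_prop
  have hgc : ContinuousOn g (Icc (0 : ℝ) 1) :=
    hwc.continuousOn.mul ((hurc.mono fun x hx ↦ mem_wide_of_mem_Icc hx).pow 2)
  have hhc : ContinuousOn h (Icc (0 : ℝ) 1) := (continuous_pow 2).continuousOn.mul hgc
  have hg0 : ∀ x ∈ Icc (0 : ℝ) 1, 0 ≤ g x := fun x hx ↦ by
    have h1 : 0 ≤ 1 - x ^ 2 := by nlinarith [hx.1, hx.2]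
    simp only [hg]; positivity
  have hh0 : ∀ x ∈ Icc (0 : ℝ) 1, 0 ≤ h x := fun x hx ↦ by
    simp only [hh]; exact mul_nonneg (sq_nonneg x) (hg0 x hx)
  have hhg : ∀ x ∈ Icc (0 : ℝ) 1, h x ≤ g x := fun x hx ↦ by
    have h1 : x ^ 2 ≤ 1 := by nlinarith [hx.1, hx.2]
    simp only [hh]
    calc x ^ 2 * ((1 - x ^ 2) ^ m * ur x ^ 2) ≤ 1 * ((1 - x ^ 2) ^ m * ur x ^ 2) :=
          mul_le_mul_of_nonneg_right h1 (hg0 x hx)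
      _ = g x := one_mul _
  -- a point near the pole where `ur > 1/2`, `0 < x < 1`
  obtain ⟨c, hc0, hc1, hurc'⟩ : ∃ c : ℝ, 1 / 2 < c ∧ c < 1 ∧ 1 / 2 < ur c := by
    have hcont1 : ContinuousAt ur 1 := hurc.continuousAt (Ioo_mem_nhds (by norm_num) (by norm_num))
    have hu1 : ur 1 = 1 := by simp [hur, sphmFun_zero]
    have hev : ∀ᶠ x in 𝓝 (1 : ℝ), 1 / 2 < ur x := hcont1.eventually (lt_mem_nhds (by rw [hu1]; norm_num))
    have hev' : ∀ᶠ x in 𝓝[<] (1 : ℝ), 1 / 2 < ur x ∧ x ∈ Ioo (1 / 2 : ℝ) 1 :=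
      (hev.filter_mono nhdsWithin_le_nhds).and (Ioo_mem_nhdsLT (by norm_num))
    obtain ⟨c, hc1, hc2⟩ := hev'.exists
    exact ⟨c, hc2.1, hc2.2, hc1⟩
  have hcI : c ∈ Icc (0 : ℝ) 1 := ⟨by linarith, hc1.le⟩
  have hposh : 0 < h c := by
    have h1 : 0 < 1 - c ^ 2 := by nlinarith
    have h2 : 0 < ur c := by linarith
    simp only [hh]; positivity
  have hlt : h c < g c := by
    have h1 : 0 < 1 - c ^ 2 := by nlinarith
    have h2 : 0 < ur c := by linarith
    have h3 : c ^ 2 < 1 := by nlinarith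
    have hgpos : 0 < (1 - c ^ 2) ^ m * ur c ^ 2 := by positivity
    simp only [hh, hg]
    calc c ^ 2 * ((1 - c ^ 2) ^ m * ur c ^ 2) < 1 * ((1 - c ^ 2) ^ m * ur c ^ 2) :=
          mul_lt_mul_of_pos_right h3 hgpos
      _ = _ := one_mul _
  refine ⟨∫ x in (0 : ℝ)..1, g x, ∫ x in (0 : ℝ)..1, h x, ?_, ?_, ?_, ?_⟩
  · have hJ := integral_lt_integral_of_continuousOn_of_le_of_exists_lt zero_lt_one continuousOn_const hhc
      (fun x hx ↦ hh0 x (Ioc_subset_Icc_self hx)) ⟨c, hcI, hposh⟩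
    simpa using hJ
  · exact integral_lt_integral_of_continuousOn_of_le_of_exists_lt zero_lt_one hhc hgc
      (fun x hx ↦ hhg x (Ioc_subset_Icc_self hx)) ⟨c, hcI, hlt⟩
  · rw [← intervalIntegral.integral_ofReal]
    refine integral_congr fun x hx ↦ ?_
    rw [uIcc_of_le zero_le_one] at hx
    simp only [hg, hreal x (mem_wide_of_mem_Icc hx)]
    push_cast
    ring
  · rw [← intervalIntegral.integral_ofReal]
    refine integral_congr fun x hx ↦ ?_
    rw [uIcc_of_le zero_le_one] at hx
    simp only [hh, hreal x (mem_wide_of_mem_Icc hx)]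
    push_cast
    ring

/-- **The slope of a real eigenvalue branch lies in `(−1, 0)`.** At a real zero `(ν₀, κ₀)` of the
shooting function, `∂F/∂ν = sphmDerD m ν₀ κ₀ 1` and `∂F/∂κ = sphmDerK m ν₀ κ₀ 1` are real, non-zero,
and `0 < (∂F/∂κ)/(∂F/∂ν) < 1`: `q(1) ∂F/∂ν = −∫(1 − x²)^m u²`, `q(1) ∂F/∂κ = −∫ x²(1 − x²)^m u²`.
Hence along a real branch `ν(κ)` of zeros, `ν'(κ) = −(∂F/∂κ)/(∂F/∂ν) ∈ (−1, 0)`: the eigenvalue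
`λ = ν + m(m+1)` decreases with `κ` at rate `< 1`, `|λ(κ) − λ(0)| ≤ |κ|` (SR App. B, Prop. B.3 type
bounds: `∂λ/∂κ = −∫ cos²θ |S|² / ∫ |S|²`). [cite: ShlapentokhRothman2014KleinGordon, App. B] -/
theorem shooting_slope_mem_Ioo (hν : ν.im = 0) (hκ : κ.im = 0) (hF : sphmDer m ν κ 1 = 0) :
    ∃ ρ : ℝ, 0 < ρ ∧ ρ < 1 ∧ sphmDerK m ν κ 1 = (ρ : ℂ) * sphmDerD m ν κ 1 ∧ sphmDerD m ν κ 1 ≠ 0 := by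
  obtain ⟨I, J, hJ, hJI, hintI, hintJ⟩ := integral_weights_sq_pos_lt (m := m) hν hκ
  have hI : 0 < I := hJ.trans hJI
  have hD := sphmFun_one_mul_sphmDerD_one (m := m) hF
  have hK := sphmFun_one_mul_sphmDerK_one (m := m) hF
  rw [hintI] at hD
  rw [hintJ] at hK
  have hq : sphmFun m ν κ 1 ≠ 0 := by
    intro h0
    rw [h0, zero_mul] at hD
    have : (I : ℂ) = 0 := by linear_combination hD
    exact hI.ne' (by exact_mod_cast this)
  have hDne : sphmDerD m ν κ 1 ≠ 0 := by
    intro h0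
    rw [h0, mul_zero] at hD
    have : (I : ℂ) = 0 := by linear_combination hD
    exact hI.ne' (by exact_mod_cast this)
  refine ⟨J / I, div_pos hJ hI, (div_lt_one hI).2 hJI, ?_, hDne⟩
  -- `q(1) F_κ = −J`, `q(1) F_ν = −I` ⇒ `F_κ = (J/I) F_ν`
  have hIC : (I : ℂ) ≠ 0 := by exact_mod_cast hI.ne'
  apply mul_left_cancel₀ hq
  rw [hK, show sphmFun m ν κ 1 * (((J / I : ℝ)) * sphmDerD m ν κ 1) = ((J / I : ℝ) : ℂ) * (sphmFun m ν κ 1 * sphmDerD m ν κ 1)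
    by ring, hD]
  push_cast
  field_simp

end Kappa

end Literature.Analysis.SpecialFunctions

end
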